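import Summits.QuantumFields.YangMills.Theorems.FluctuationComparisonRegPrIntLOrganTangentLawEdgeIntegrationLipAE
import HarnessLib

/-!
# Crux `FluctuationComparisonRegPrIntL` (stmt-QuantumFields-20520, rung R3), PATH-B organ, H-currency cone — (L37b) THE D3∕D4 LAW SQUARE BRICKS, «AE» EDITION
# (a.e.-`s` road, LEAD w3 g27 №3 (C) ∕ №4; companion of ✓(L27c) p817232 over LEAD's (C1) ∕ (C2) and ✓(L37a))

Cell `ym3-torus` (YM ladder rung R3 = continuum `SU(2)` Yang–Mills on the three-torus — a RUNG: NOT d = 4, NOT infinite volume, NOT a mass gap, NOT Clay).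
Width seat `ym-ust-20520-w5` (gen 24), `--supports stmt-QuantumFields-20520 --as helper`, count-neutral, no registry ∕ binder ∕ `Lines/` edit, DEFINITION-FREE,
default heartbeats.  Over (C2) `abs_normMean_secondDiff_le_of_lip_ae` ∕ `abs_normVar_secondDiff_le_of_lip_ae` (LEAD w3 g27), (C1) `ae_ae_hasDerivAt_deriv_of_lipschitzOn`,
✓(L27a) `cut_null_of_nonneg`, ✓(L24) `normMean_deriv_eq_cov_of_null`, ✓(L23b)∕(L25)∕(L26a∕b) docking lemmas.

WHAT.  ✓(L27c)'s `abs_lawSquare_wgt_le_of_lip`, `lawSquareClause_of_edgeKernel_of_lip`, `varSquareClause_of_edgeKernel_of_lip` with EXACTLY these binder changes and the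
SAME conclusions: `[SFinite τ]`; `hm`∕`hm₁` ↦ `hwm : ∀ s′, Measurable (fun p : ℝ × Zc => wNum … t (X p.1 s′) p.2)`; the `s`-partial witness `w₁` and (Diff₀) `hd₁` DELETED; the kernels
read `∀ᵐ s ∂volume, s ∈ Icc 0 1 → …` with the canonical scores `deriv (fun s => wNum … t (X s s′) z) s` (`s′ ∈ {0,1}` in the (L2ʲ-h) kernel; general `s′` in the `Dφ`, `Dψ`
defining equations of the (JV4-h′) brick).  ★`abs_lawSquare_wgt_le_of_lip_ae` · ★★★`lawSquareClause_of_edgeKernel_of_lip_ae` ((L2ʲ-h) per square) ·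
★★★`varSquareClause_of_edgeKernel_of_lip_ae` ((JV4-h′) per square).

HONEST FRAMING: calculus [folklore] over HYPOTHESIS shapes; nothing of Bałaban's analysis is asserted or proved; `SpreadFibreLawH(J)(sq)` ∕ `OrganDischargeInputsHJ(sq)` exactly as
open; the five registered stubs of `Lines/semiclassical_s2beta.lean`, crux 20520 and `YM3TorusSU2` are NOT proved; registry untouched; rung R3 = SU(2) YM₃ on T³ at fixed lattice
data — NOT d = 4, NOT infinite volume, NOT a mass gap, NOT Clay; the Yang–Mills mass gap is NOT proved.  [folklore].
-/

set_option autoImplicit false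

noncomputable section

namespace Summit.QuantumFields.YangMills.Theorems.OrganTangentLawSquareIntegrationLipAE

open MeasureTheory Filter Topology Set Function
open scoped ENNReal
open Literature.MathematicalPhysics.QuantumFieldTheory.Balaban1983to89 T3ContinuumYM3Torus T3NestedUnitLaws T3UnitLawDensityEML T4Continuum BalabanUVClass
open T4CubeChartExp (expPt)
open Summit.QuantumFields.YangMills.Theorems.FluctuationComparisonRegPrIntLRunpairOrganFibreLaw (wNum wgt)
open Summit.QuantumFields.YangMills.Theorems.OrganTangentLawEdgeResponse
open Summit.QuantumFields.YangMills.Theorems.OrganTangentLawSquareResponse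
open Summit.QuantumFields.YangMills.Theorems.OrganTangentLawEdgeResponseDock
open Summit.QuantumFields.YangMills.Theorems.OrganTangentLawCumulantResponse
open Summit.QuantumFields.YangMills.Theorems.OrganTangentLawEdgeIntegration
open Summit.QuantumFields.YangMills.Theorems.OrganTangentLawCumulantIntegration
open Summit.QuantumFields.YangMills.Theorems.OrganTangentLawResponseLip
open Summit.QuantumFields.YangMills.Theorems.OrganTangentAEDifferentiableFamily (ae_ae_hasDerivAt_deriv_of_lipschitzOn)
open Summit.QuantumFields.YangMills.Theorems.OrganTangentLawResponseLipAE (abs_normMean_secondDiff_le_of_lip_ae abs_normVar_secondDiff_le_of_lip_ae)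

section Square

/-- ★ **THE LAW SQUARE ON A TWO-PARAMETER LAW FAMILY, DOCKED, AE EDITION** (conclusion = ✓`abs_lawSquare_wgt_le_of_lip`'s). [folklore] -/
theorem abs_lawSquare_wgt_le_of_lip_ae (F : T3Family) (γ b₀ p₀ : ℝ) (j Ts : ℕ)
    (ρ ρ' : (i : ℕ) → GaugeField (F.P i) 0 ↥(Matrix.specialUnitaryGroup (Fin 2) ℂ) → ℝ) {Zc : Type} [MeasurableSpace Zc] (τ : Measure Zc) [SFinite τ]
    (Φ : GaugeField (F.P j) 0 ↥(Matrix.specialUnitaryGroup (Fin 2) ℂ) × Zc → GaugeField (F.P Ts) 0 ↥(Matrix.specialUnitaryGroup (Fin 2) ℂ))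
    (J : GaugeField (F.P j) 0 ↥(Matrix.specialUnitaryGroup (Fin 2) ℂ) × Zc → NNReal) (t : ℝ)
    (X : ℝ → ℝ → GaugeField (F.P j) 0 ↥(Matrix.specialUnitaryGroup (Fin 2) ℂ)) (f : Zc → ℝ)
    {U : Set ℝ} (hU : IsOpen U) (hUI : Icc (0:ℝ) 1 ⊆ U)
    (hf : AEStronglyMeasurable f τ) (hwm : ∀ s', Measurable (fun p : ℝ × Zc => wNum F γ b₀ p₀ j Ts ρ ρ' Φ J t (X p.1 s') p.2))
    (hi : ∀ s ∈ Icc (0:ℝ) 1, ∀ s' ∈ Icc (0:ℝ) 1, Integrable (fun z => wNum F γ b₀ p₀ j Ts ρ ρ' Φ J t (X s s') z) τ)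
    (hiG : ∀ s ∈ Icc (0:ℝ) 1, ∀ s' ∈ Icc (0:ℝ) 1, Integrable (fun z => f z * wNum F γ b₀ p₀ j Ts ρ ρ' Φ J t (X s s') z) τ)
    {b₁ : Zc → ℝ} (hlip : ∀ s' ∈ Icc (0:ℝ) 1, ∀ᵐ z ∂τ, LipschitzOnWith (Real.nnabs (b₁ z)) (fun s => wNum F γ b₀ p₀ j Ts ρ ρ' Φ J t (X s s') z) U) (hb₁i : Integrable b₁ τ)
    {b₁G : Zc → ℝ} (hlipG : ∀ s' ∈ Icc (0:ℝ) 1, ∀ᵐ z ∂τ, LipschitzOnWith (Real.nnabs (b₁G z)) (fun s => f z * wNum F γ b₀ p₀ j Ts ρ ρ' Φ J t (X s s') z) U) (hb₁Gi : Integrable b₁G τ)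
    (hZ : ∀ s ∈ Icc (0:ℝ) 1, ∀ s' ∈ Icc (0:ℝ) 1, (∫ z, wNum F γ b₀ p₀ j Ts ρ ρ' Φ J t (X s s') z ∂τ) ≠ 0) {ℓ : ℝ}
    (hker : ∀ᵐ s ∂(volume : Measure ℝ), s ∈ Icc (0:ℝ) 1 → |((∫ z, f z * deriv (fun s => wNum F γ b₀ p₀ j Ts ρ ρ' Φ J t (X s 1) z) s ∂τ) / (∫ z, wNum F γ b₀ p₀ j Ts ρ ρ' Φ J t (X s 1) z ∂τ) - ((∫ z, f z * wNum F γ b₀ p₀ j Ts ρ ρ' Φ J t (X s 1) z ∂τ) / (∫ z, wNum F γ b₀ p₀ j Ts ρ ρ' Φ J t (X s 1) z ∂τ)) * ((∫ z, deriv (fun s => wNum F γ b₀ p₀ j Ts ρ ρ' Φ J t (X s 1) z) s ∂τ) / (∫ z, wNum F γ b₀ p₀ j Ts ρ ρ' Φ J t (X s 1) z ∂τ)))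
        - ((∫ z, f z * deriv (fun s => wNum F γ b₀ p₀ j Ts ρ ρ' Φ J t (X s 0) z) s ∂τ) / (∫ z, wNum F γ b₀ p₀ j Ts ρ ρ' Φ J t (X s 0) z ∂τ) - ((∫ z, f z * wNum F γ b₀ p₀ j Ts ρ ρ' Φ J t (X s 0) z ∂τ) / (∫ z, wNum F γ b₀ p₀ j Ts ρ ρ' Φ J t (X s 0) z ∂τ)) * ((∫ z, deriv (fun s => wNum F γ b₀ p₀ j Ts ρ ρ' Φ J t (X s 0) z) s ∂τ) / (∫ z, wNum F γ b₀ p₀ j Ts ρ ρ' Φ J t (X s 0) z ∂τ)))| ≤ ℓ) :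
    |(∫ z, f z * (wgt F γ b₀ p₀ j Ts ρ ρ' τ Φ J t) (X 1 1) z ∂τ) - (∫ z, f z * (wgt F γ b₀ p₀ j Ts ρ ρ' τ Φ J t) (X 1 0) z ∂τ)
      - (∫ z, f z * (wgt F γ b₀ p₀ j Ts ρ ρ' τ Φ J t) (X 0 1) z ∂τ) + (∫ z, f z * (wgt F γ b₀ p₀ j Ts ρ ρ' τ Φ J t) (X 0 0) z ∂τ)| ≤ ℓ := by
  rw [integral_mul_wgt_eq_div, integral_mul_wgt_eq_div, integral_mul_wgt_eq_div, integral_mul_wgt_eq_div]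
  exact abs_normMean_secondDiff_le_of_lip_ae (w := fun s s' z => wNum F γ b₀ p₀ j Ts ρ ρ' Φ J t (X s s') z) hU hUI hf hwm hi hiG hlip hb₁i hlipG hb₁Gi hZ hker

/-- ★★★ **THE D3 INTEGRATION BRICK FOR (L2ʲ-h), AE EDITION** (conclusion VERBATIM; no `w₁`, no (Diff₀), kernel `∀ᵐ s`). [folklore] -/
theorem lawSquareClause_of_edgeKernel_of_lip_ae (F : T3Family) (γ b₀ p₀ : ℝ) (j Ts : ℕ)
    (ρ ρ' : (i : ℕ) → GaugeField (F.P i) 0 ↥(Matrix.specialUnitaryGroup (Fin 2) ℂ) → ℝ) {Zc : Type} [MeasurableSpace Zc] (τ : Measure Zc) [SFinite τ]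
    (Φ : GaugeField (F.P j) 0 ↥(Matrix.specialUnitaryGroup (Fin 2) ℂ) × Zc → GaugeField (F.P Ts) 0 ↥(Matrix.specialUnitaryGroup (Fin 2) ℂ))
    (J : GaugeField (F.P j) 0 ↥(Matrix.specialUnitaryGroup (Fin 2) ℂ) × Zc → NNReal) (t : ℝ)
    (V00 V10 V01 V11 : GaugeField (F.P j) 0 ↥(Matrix.specialUnitaryGroup (Fin 2) ℂ))
    (X : ℝ → ℝ → GaugeField (F.P j) 0 ↥(Matrix.specialUnitaryGroup (Fin 2) ℂ)) (hX00 : X 0 0 = V00) (hX10 : X 1 0 = V10) (hX01 : X 0 1 = V01)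
    (hX11 : X 1 1 = V11) {U : Set ℝ} (hU : IsOpen U) (hUI : Icc (0:ℝ) 1 ⊆ U)
    (hw0 : ∀ s s' z, 0 ≤ wNum F γ b₀ p₀ j Ts ρ ρ' Φ J t (X s s') z)
    (hmF : AEStronglyMeasurable (fun z => (Real.log (ρ Ts (Φ (V00, z))) - Real.log (ρ' Ts (Φ (V00, z))))) τ)
    (hwm : ∀ s', Measurable (fun p : ℝ × Zc => wNum F γ b₀ p₀ j Ts ρ ρ' Φ J t (X p.1 s') p.2))
    (hi : ∀ s ∈ Icc (0:ℝ) 1, ∀ s' ∈ Icc (0:ℝ) 1, Integrable (fun z => wNum F γ b₀ p₀ j Ts ρ ρ' Φ J t (X s s') z) τ)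
    (hiG : ∀ s ∈ Icc (0:ℝ) 1, ∀ s' ∈ Icc (0:ℝ) 1, Integrable (fun z => (Real.log (ρ Ts (Φ (V00, z))) - Real.log (ρ' Ts (Φ (V00, z)))) * wNum F γ b₀ p₀ j Ts ρ ρ' Φ J t (X s s') z) τ)
    {b₁ : Zc → ℝ} (hlip : ∀ s' ∈ Icc (0:ℝ) 1, ∀ᵐ z ∂τ, LipschitzOnWith (Real.nnabs (b₁ z)) (fun s => wNum F γ b₀ p₀ j Ts ρ ρ' Φ J t (X s s') z) U) (hb₁i : Integrable b₁ τ)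
    {b₁G : Zc → ℝ} (hlipG : ∀ s' ∈ Icc (0:ℝ) 1, ∀ᵐ z ∂τ, LipschitzOnWith (Real.nnabs (b₁G z)) (fun s => (Real.log (ρ Ts (Φ (V00, z))) - Real.log (ρ' Ts (Φ (V00, z)))) * wNum F γ b₀ p₀ j Ts ρ ρ' Φ J t (X s s') z) U) (hb₁Gi : Integrable b₁G τ)
    (hZ : ∀ s ∈ Icc (0:ℝ) 1, ∀ s' ∈ Icc (0:ℝ) 1, (∫ z, wNum F γ b₀ p₀ j Ts ρ ρ' Φ J t (X s s') z ∂τ) ≠ 0) {ℓ : ℝ}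
    (hker : ∀ᵐ s ∂(volume : Measure ℝ), s ∈ Icc (0:ℝ) 1 →
      |((∫ z, (Real.log (ρ Ts (Φ (V00, z))) - Real.log (ρ' Ts (Φ (V00, z)))) * (deriv (fun s => wNum F γ b₀ p₀ j Ts ρ ρ' Φ J t (X s 1) z) s / wNum F γ b₀ p₀ j Ts ρ ρ' Φ J t (X s 1) z) * (wNum F γ b₀ p₀ j Ts ρ ρ' Φ J t (X s 1) z / ∫ z', wNum F γ b₀ p₀ j Ts ρ ρ' Φ J t (X s 1) z' ∂τ) ∂τ)
          - (∫ z, (Real.log (ρ Ts (Φ (V00, z))) - Real.log (ρ' Ts (Φ (V00, z)))) * (wNum F γ b₀ p₀ j Ts ρ ρ' Φ J t (X s 1) z / ∫ z', wNum F γ b₀ p₀ j Ts ρ ρ' Φ J t (X s 1) z' ∂τ) ∂τ) * (∫ z, (deriv (fun s => wNum F γ b₀ p₀ j Ts ρ ρ' Φ J t (X s 1) z) s / wNum F γ b₀ p₀ j Ts ρ ρ' Φ J t (X s 1) z) * (wNum F γ b₀ p₀ j Ts ρ ρ' Φ J t (X s 1) z / ∫ z', wNum F γ b₀ p₀ j Ts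 ρ ρ' Φ J t (X s 1) z' ∂τ) ∂τ))
        - ((∫ z, (Real.log (ρ Ts (Φ (V00, z))) - Real.log (ρ' Ts (Φ (V00, z)))) * (deriv (fun s => wNum F γ b₀ p₀ j Ts ρ ρ' Φ J t (X s 0) z) s / wNum F γ b₀ p₀ j Ts ρ ρ' Φ J t (X s 0) z) * (wNum F γ b₀ p₀ j Ts ρ ρ' Φ J t (X s 0) z / ∫ z', wNum F γ b₀ p₀ j Ts ρ ρ' Φ J t (X s 0) z' ∂τ) ∂τ)
          - (∫ z, (Real.log (ρ Ts (Φ (V00, z))) - Real.log (ρ' Ts (Φ (V00, z)))) * (wNum F γ b₀ p₀ j Ts ρ ρ' Φ J t (X s 0) z / ∫ z', wNum F γ b₀ p₀ j Ts ρ ρ' Φ J t (X s 0) z' ∂τ) ∂τ) * (∫ z, (deriv (fun s => wNum F γ b₀ p₀ j Ts ρ ρ' Φ J t (X s 0) z) s / wNum F γ b₀ p₀ j Ts ρ ρ' Φ J t (X s 0) z) * (wNum F γ b₀ p₀ j Ts ρ ρ' Φ J t (X s 0) z / ∫ z', wNum F γ b₀ p₀ j Ts ρ ρ' Φ J t (X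 s 0) z' ∂τ) ∂τ))| ≤ ℓ) :
    Integrable (fun z => (Real.log (ρ Ts (Φ (V00, z))) - Real.log (ρ' Ts (Φ (V00, z)))) * (wgt F γ b₀ p₀ j Ts ρ ρ' τ Φ J t) V00 z) τ ∧
    Integrable (fun z => (Real.log (ρ Ts (Φ (V00, z))) - Real.log (ρ' Ts (Φ (V00, z)))) * (wgt F γ b₀ p₀ j Ts ρ ρ' τ Φ J t) V10 z) τ ∧
    Integrable (fun z => (Real.log (ρ Ts (Φ (V00, z))) - Real.log (ρ' Ts (Φ (V00, z)))) * (wgt F γ b₀ p₀ j Ts ρ ρ' τ Φ J t) V01 z) τ ∧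
    Integrable (fun z => (Real.log (ρ Ts (Φ (V00, z))) - Real.log (ρ' Ts (Φ (V00, z)))) * (wgt F γ b₀ p₀ j Ts ρ ρ' τ Φ J t) V11 z) τ ∧
    |(∫ z, (Real.log (ρ Ts (Φ (V00, z))) - Real.log (ρ' Ts (Φ (V00, z)))) * (wgt F γ b₀ p₀ j Ts ρ ρ' τ Φ J t) V11 z ∂τ)
      - (∫ z, (Real.log (ρ Ts (Φ (V00, z))) - Real.log (ρ' Ts (Φ (V00, z)))) * (wgt F γ b₀ p₀ j Ts ρ ρ' τ Φ J t) V10 z ∂τ)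
      - (∫ z, (Real.log (ρ Ts (Φ (V00, z))) - Real.log (ρ' Ts (Φ (V00, z)))) * (wgt F γ b₀ p₀ j Ts ρ ρ' τ Φ J t) V01 z ∂τ)
      + (∫ z, (Real.log (ρ Ts (Φ (V00, z))) - Real.log (ρ' Ts (Φ (V00, z)))) * (wgt F γ b₀ p₀ j Ts ρ ρ' τ Φ J t) V00 z ∂τ)| ≤ ℓ := by
  have h1 : (1:ℝ) ∈ Icc (0:ℝ) 1 := ⟨zero_le_one, le_rfl⟩
  have h0 : (0:ℝ) ∈ Icc (0:ℝ) 1 := ⟨le_rfl, zero_le_one⟩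
  have i00 := integrable_mul_wgt_of_wNum F γ b₀ p₀ j Ts ρ ρ' τ Φ J t (X 0 0) _ (hiG 0 h0 0 h0)
  have i10 := integrable_mul_wgt_of_wNum F γ b₀ p₀ j Ts ρ ρ' τ Φ J t (X 1 0) _ (hiG 1 h1 0 h0)
  have i01 := integrable_mul_wgt_of_wNum F γ b₀ p₀ j Ts ρ ρ' τ Φ J t (X 0 1) _ (hiG 0 h0 1 h1)
  have i11 := integrable_mul_wgt_of_wNum F γ b₀ p₀ j Ts ρ ρ' τ Φ J t (X 1 1) _ (hiG 1 h1 1 h1)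
  rw [hX00] at i00
  rw [hX10] at i10
  rw [hX01] at i01
  rw [hX11] at i11
  -- the score kernel in raw form (cut clause from non-negativity at `s′ = 1` and `s′ = 0`)
  have hraw : ∀ᵐ s ∂(volume : Measure ℝ), s ∈ Icc (0:ℝ) 1 → |((∫ z, (Real.log (ρ Ts (Φ (V00, z))) - Real.log (ρ' Ts (Φ (V00, z)))) * deriv (fun s => wNum F γ b₀ p₀ j Ts ρ ρ' Φ J t (X s 1) z) s ∂τ) / (∫ z, wNum F γ b₀ p₀ j Ts ρ ρ' Φ J t (X s 1) z ∂τ) - ((∫ z, (Real.log (ρ Ts (Φ (V00, z))) - Real.log (ρ' Ts (Φ (V00, z)))) * wNum F γ b₀ p₀ j Ts ρ ρ' Φ J t (X s 1) z ∂τ) / (∫ z, wNum F γ b₀ p₀ j Ts ρ ρ' Φ J t (X s 1) z ∂τ)) * ((∫ z, deriv (fun s => wNum F γ b₀ p₀ j Ts ρ ρ' Φ J t (X s 1) z) s ∂τ) / (∫ z, wNum F γ b₀ p₀ j Ts ρ ρ' Φ J t (X s 1) z ∂τ)))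
        - ((∫ z, (Real.log (ρ Ts (Φ (V00, z))) - Real.log (ρ' Ts (Φ (V00, z)))) * deriv (fun s => wNum F γ b₀ p₀ j Ts ρ ρ' Φ J t (X s 0) z) s ∂τ) / (∫ z, wNum F γ b₀ p₀ j Ts ρ ρ' Φ J t (X s 0) z ∂τ) - ((∫ z, (Real.log (ρ Ts (Φ (V00, z))) - Real.log (ρ' Ts (Φ (V00, z)))) * wNum F γ b₀ p₀ j Ts ρ ρ' Φ J t (X s 0) z ∂τ) / (∫ z, wNum F γ b₀ p₀ j Ts ρ ρ' Φ J t (X s 0) z ∂τ)) * ((∫ z, deriv (fun s => wNum F γ b₀ p₀ j Ts ρ ρ' Φ J t (X s 0) z) s ∂τ) / (∫ z, wNum F γ b₀ p₀ j Ts ρ ρ' Φ J t (X s 0) z ∂τ)))| ≤ ℓ := by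
    filter_upwards [ae_ae_hasDerivAt_deriv_of_lipschitzOn (w := fun s z => wNum F γ b₀ p₀ j Ts ρ ρ' Φ J t (X s 1) z) hU hUI τ (hwm 1) (hlip 1 h1),
      ae_ae_hasDerivAt_deriv_of_lipschitzOn (w := fun s z => wNum F γ b₀ p₀ j Ts ρ ρ' Φ J t (X s 0) z) hU hUI τ (hwm 0) (hlip 0 h0), hker] with s hs1 hs0 hc hsI
    have n1 := cut_null_of_nonneg (w := fun s z => wNum F γ b₀ p₀ j Ts ρ ρ' Φ J t (X s 1) z) (w'₀ := fun z => deriv (fun s => wNum F γ b₀ p₀ j Ts ρ ρ' Φ J t (X s 1) z) s) (s₀ := s) (fun s z => hw0 s 1 z) (hs1 hsI)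
    have n0 := cut_null_of_nonneg (w := fun s z => wNum F γ b₀ p₀ j Ts ρ ρ' Φ J t (X s 0) z) (w'₀ := fun z => deriv (fun s => wNum F γ b₀ p₀ j Ts ρ ρ' Φ J t (X s 0) z) s) (s₀ := s) (fun s z => hw0 s 0 z) (hs0 hsI)
    rw [normMean_deriv_eq_cov_of_null (w := fun s z => wNum F γ b₀ p₀ j Ts ρ ρ' Φ J t (X s 1) z) (w' := fun s z => deriv (fun s => wNum F γ b₀ p₀ j Ts ρ ρ' Φ J t (X s 1) z) s) (G := fun z => (Real.log (ρ Ts (Φ (V00, z))) - Real.log (ρ' Ts (Φ (V00, z))))) (s₀ := s) n1,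
      normMean_deriv_eq_cov_of_null (w := fun s z => wNum F γ b₀ p₀ j Ts ρ ρ' Φ J t (X s 0) z) (w' := fun s z => deriv (fun s => wNum F γ b₀ p₀ j Ts ρ ρ' Φ J t (X s 0) z) s) (G := fun z => (Real.log (ρ Ts (Φ (V00, z))) - Real.log (ρ' Ts (Φ (V00, z))))) (s₀ := s) n0]
    exact hc hsI
  have hsq := abs_lawSquare_wgt_le_of_lip_ae F γ b₀ p₀ j Ts ρ ρ' τ Φ J t X (fun z => (Real.log (ρ Ts (Φ (V00, z))) - Real.log (ρ' Ts (Φ (V00, z))))) hU hUI hmF hwm hi hiG hlip hb₁i hlipG hb₁Gi hZ hraw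
  rw [hX00, hX10, hX01, hX11] at hsq
  exact ⟨i00, i10, i01, i11, hsq⟩

end Square

section VarSquare

/-- ★★★ **THE D4 LAW-SIDE BRICK FOR (JV4-h′), AE EDITION** (conclusion VERBATIM; `Dφ`, `Dψ` read with the canonical scores). [folklore] -/
theorem varSquareClause_of_edgeKernel_of_lip_ae (F : T3Family) (γ b₀ p₀ : ℝ) (j Ts : ℕ)
    (ρ ρ' : (i : ℕ) → GaugeField (F.P i) 0 ↥(Matrix.specialUnitaryGroup (Fin 2) ℂ) → ℝ) {Zc : Type} [MeasurableSpace Zc] (τ : Measure Zc) [SFinite τ]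
    (Φ : GaugeField (F.P j) 0 ↥(Matrix.specialUnitaryGroup (Fin 2) ℂ) × Zc → GaugeField (F.P Ts) 0 ↥(Matrix.specialUnitaryGroup (Fin 2) ℂ))
    (J : GaugeField (F.P j) 0 ↥(Matrix.specialUnitaryGroup (Fin 2) ℂ) × Zc → NNReal) (t : ℝ)
    (V00 V10 V01 V11 : GaugeField (F.P j) 0 ↥(Matrix.specialUnitaryGroup (Fin 2) ℂ))
    (X : ℝ → ℝ → GaugeField (F.P j) 0 ↥(Matrix.specialUnitaryGroup (Fin 2) ℂ)) (hX00 : X 0 0 = V00) (hX10 : X 1 0 = V10) (hX01 : X 0 1 = V01)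
    (hX11 : X 1 1 = V11) {U : Set ℝ} (hU : IsOpen U) (hUI : Icc (0:ℝ) 1 ⊆ U)
    (hmF : AEStronglyMeasurable (fun z => (Real.log (ρ Ts (Φ (V00, z))) - Real.log (ρ' Ts (Φ (V00, z))))) τ)
    (hwm : ∀ s', Measurable (fun p : ℝ × Zc => wNum F γ b₀ p₀ j Ts ρ ρ' Φ J t (X p.1 s') p.2))
    (hi : ∀ s ∈ Icc (0:ℝ) 1, ∀ s' ∈ Icc (0:ℝ) 1, Integrable (fun z => wNum F γ b₀ p₀ j Ts ρ ρ' Φ J t (X s s') z) τ)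
    (hiF : ∀ s ∈ Icc (0:ℝ) 1, ∀ s' ∈ Icc (0:ℝ) 1, Integrable (fun z => (Real.log (ρ Ts (Φ (V00, z))) - Real.log (ρ' Ts (Φ (V00, z)))) * wNum F γ b₀ p₀ j Ts ρ ρ' Φ J t (X s s') z) τ)
    (hiFF : ∀ s ∈ Icc (0:ℝ) 1, ∀ s' ∈ Icc (0:ℝ) 1, Integrable (fun z => ((Real.log (ρ Ts (Φ (V00, z))) - Real.log (ρ' Ts (Φ (V00, z)))) * (Real.log (ρ Ts (Φ (V00, z))) - Real.log (ρ' Ts (Φ (V00, z))))) * wNum F γ b₀ p₀ j Ts ρ ρ' Φ J t (X s s') z) τ)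
    {b₁ : Zc → ℝ} (hlip : ∀ s' ∈ Icc (0:ℝ) 1, ∀ᵐ z ∂τ, LipschitzOnWith (Real.nnabs (b₁ z)) (fun s => wNum F γ b₀ p₀ j Ts ρ ρ' Φ J t (X s s') z) U) (hb₁i : Integrable b₁ τ)
    {b₁F : Zc → ℝ} (hlipF : ∀ s' ∈ Icc (0:ℝ) 1, ∀ᵐ z ∂τ, LipschitzOnWith (Real.nnabs (b₁F z)) (fun s => (Real.log (ρ Ts (Φ (V00, z))) - Real.log (ρ' Ts (Φ (V00, z)))) * wNum F γ b₀ p₀ j Ts ρ ρ' Φ J t (X s s') z) U) (hb₁Fi : Integrable b₁F τ)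
    {b₁FF : Zc → ℝ} (hlipFF : ∀ s' ∈ Icc (0:ℝ) 1, ∀ᵐ z ∂τ, LipschitzOnWith (Real.nnabs (b₁FF z)) (fun s => ((Real.log (ρ Ts (Φ (V00, z))) - Real.log (ρ' Ts (Φ (V00, z)))) * (Real.log (ρ Ts (Φ (V00, z))) - Real.log (ρ' Ts (Φ (V00, z))))) * wNum F γ b₀ p₀ j Ts ρ ρ' Φ J t (X s s') z) U)
    (hb₁FFi : Integrable b₁FF τ)
    (hZ : ∀ s ∈ Icc (0:ℝ) 1, ∀ s' ∈ Icc (0:ℝ) 1, (∫ z, wNum F γ b₀ p₀ j Ts ρ ρ' Φ J t (X s s') z ∂τ) ≠ 0)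
    (φ ψ Dφ Dψ : ℝ → ℝ → ℝ)
    (hφ : ∀ s s', φ s s' = (∫ z, (Real.log (ρ Ts (Φ (V00, z))) - Real.log (ρ' Ts (Φ (V00, z)))) * wNum F γ b₀ p₀ j Ts ρ ρ' Φ J t (X s s') z ∂τ) / (∫ z, wNum F γ b₀ p₀ j Ts ρ ρ' Φ J t (X s s') z ∂τ))
    (hψ : ∀ s s', ψ s s' = (∫ z, ((Real.log (ρ Ts (Φ (V00, z))) - Real.log (ρ' Ts (Φ (V00, z)))) * (Real.log (ρ Ts (Φ (V00, z))) - Real.log (ρ' Ts (Φ (V00, z))))) * wNum F γ b₀ p₀ j Ts ρ ρ' Φ J t (X s s') z ∂τ) / (∫ z, wNum F γ b₀ p₀ j Ts ρ ρ' Φ J t (X s s') z ∂τ))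
    (hDφ : ∀ s s', Dφ s s' = (∫ z, (Real.log (ρ Ts (Φ (V00, z))) - Real.log (ρ' Ts (Φ (V00, z)))) * deriv (fun s => wNum F γ b₀ p₀ j Ts ρ ρ' Φ J t (X s s') z) s ∂τ) / (∫ z, wNum F γ b₀ p₀ j Ts ρ ρ' Φ J t (X s s') z ∂τ)
      - ((∫ z, (Real.log (ρ Ts (Φ (V00, z))) - Real.log (ρ' Ts (Φ (V00, z)))) * wNum F γ b₀ p₀ j Ts ρ ρ' Φ J t (X s s') z ∂τ) / (∫ z, wNum F γ b₀ p₀ j Ts ρ ρ' Φ J t (X s s') z ∂τ)) * ((∫ z, deriv (fun s => wNum F γ b₀ p₀ j Ts ρ ρ' Φ J t (X s s') z) s ∂τ) / (∫ z, wNum F γ b₀ p₀ j Ts ρ ρ' Φ J t (X s s') z ∂τ)))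
    (hDψ : ∀ s s', Dψ s s' = (∫ z, ((Real.log (ρ Ts (Φ (V00, z))) - Real.log (ρ' Ts (Φ (V00, z)))) * (Real.log (ρ Ts (Φ (V00, z))) - Real.log (ρ' Ts (Φ (V00, z))))) * deriv (fun s => wNum F γ b₀ p₀ j Ts ρ ρ' Φ J t (X s s') z) s ∂τ) / (∫ z, wNum F γ b₀ p₀ j Ts ρ ρ' Φ J t (X s s') z ∂τ)
      - ((∫ z, ((Real.log (ρ Ts (Φ (V00, z))) - Real.log (ρ' Ts (Φ (V00, z)))) * (Real.log (ρ Ts (Φ (V00, z))) - Real.log (ρ' Ts (Φ (V00, z))))) * wNum F γ b₀ p₀ j Ts ρ ρ' Φ J t (X s s') z ∂τ) / (∫ z, wNum F γ b₀ p₀ j Ts ρ ρ' Φ J t (X s s') z ∂τ)) * ((∫ z, deriv (fun s => wNum F γ b₀ p₀ j Ts ρ ρ' Φ J t (X s s') z) s ∂τ) / (∫ z, wNum F γ b₀ p₀ j Ts ρ ρ' Φ J t (X s s') z ∂τ)))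
    {ℓ : ℝ} (hker : ∀ᵐ s ∂(volume : Measure ℝ), s ∈ Icc (0:ℝ) 1 →
      |(Dψ s 1 - (Dφ s 1 * φ s 1 + φ s 1 * Dφ s 1)) - (Dψ s 0 - (Dφ s 0 * φ s 0 + φ s 0 * Dφ s 0))| ≤ ℓ) :
    ∀ (c₀₀ c₁₀ c₀₁ c₁₁ : ℝ), c₀₀ = ∫ z, (Real.log (ρ Ts (Φ (V00, z))) - Real.log (ρ' Ts (Φ (V00, z)))) * (wgt F γ b₀ p₀ j Ts ρ ρ' τ Φ J t) V00 z ∂τ → c₁₀ = ∫ z, (Real.log (ρ Ts (Φ (V00, z))) - Real.log (ρ' Ts (Φ (V00, z)))) * (wgt F γ b₀ p₀ j Ts ρ ρ' τ Φ J t) V10 z ∂τ →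
      c₀₁ = ∫ z, (Real.log (ρ Ts (Φ (V00, z))) - Real.log (ρ' Ts (Φ (V00, z)))) * (wgt F γ b₀ p₀ j Ts ρ ρ' τ Φ J t) V01 z ∂τ → c₁₁ = ∫ z, (Real.log (ρ Ts (Φ (V00, z))) - Real.log (ρ' Ts (Φ (V00, z)))) * (wgt F γ b₀ p₀ j Ts ρ ρ' τ Φ J t) V11 z ∂τ →
      Integrable (fun z => ((Real.log (ρ Ts (Φ (V00, z))) - Real.log (ρ' Ts (Φ (V00, z)))) - c₀₀) ^ 2 * (wgt F γ b₀ p₀ j Ts ρ ρ' τ Φ J t) V00 z) τ ∧ Integrable (fun z => ((Real.log (ρ Ts (Φ (V00, z))) - Real.log (ρ' Ts (Φ (V00, z)))) - c₁₀) ^ 2 * (wgt F γ b₀ p₀ j Ts ρ ρ' τ Φ J t) V10 z) τ ∧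
      Integrable (fun z => ((Real.log (ρ Ts (Φ (V00, z))) - Real.log (ρ' Ts (Φ (V00, z)))) - c₀₁) ^ 2 * (wgt F γ b₀ p₀ j Ts ρ ρ' τ Φ J t) V01 z) τ ∧ Integrable (fun z => ((Real.log (ρ Ts (Φ (V00, z))) - Real.log (ρ' Ts (Φ (V00, z)))) - c₁₁) ^ 2 * (wgt F γ b₀ p₀ j Ts ρ ρ' τ Φ J t) V11 z) τ ∧
      |(∫ z, ((Real.log (ρ Ts (Φ (V00, z))) - Real.log (ρ' Ts (Φ (V00, z)))) - c₁₁) ^ 2 * (wgt F γ b₀ p₀ j Ts ρ ρ' τ Φ J t) V11 z ∂τ) - (∫ z, ((Real.log (ρ Ts (Φ (V00, z))) - Real.log (ρ' Ts (Φ (V00, z)))) - c₁₀) ^ 2 * (wgt F γ b₀ p₀ j Ts ρ ρ' τ Φ J t) V10 z ∂τ)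
        - (∫ z, ((Real.log (ρ Ts (Φ (V00, z))) - Real.log (ρ' Ts (Φ (V00, z)))) - c₀₁) ^ 2 * (wgt F γ b₀ p₀ j Ts ρ ρ' τ Φ J t) V01 z ∂τ) + (∫ z, ((Real.log (ρ Ts (Φ (V00, z))) - Real.log (ρ' Ts (Φ (V00, z)))) - c₀₀) ^ 2 * (wgt F γ b₀ p₀ j Ts ρ ρ' τ Φ J t) V00 z ∂τ)| ≤ ℓ := by
  intro c₀₀ c₁₀ c₀₁ c₁₁ hc₀₀ hc₁₀ hc₀₁ hc₁₁
  have h1 : (1:ℝ) ∈ Icc (0:ℝ) 1 := ⟨zero_le_one, le_rfl⟩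
  have h0 : (0:ℝ) ∈ Icc (0:ℝ) 1 := ⟨le_rfl, zero_le_one⟩
  have iF00 := integrable_mul_wgt_of_wNum F γ b₀ p₀ j Ts ρ ρ' τ Φ J t (X 0 0) _ (hiF 0 h0 0 h0)
  have iF10 := integrable_mul_wgt_of_wNum F γ b₀ p₀ j Ts ρ ρ' τ Φ J t (X 1 0) _ (hiF 1 h1 0 h0)
  have iF01 := integrable_mul_wgt_of_wNum F γ b₀ p₀ j Ts ρ ρ' τ Φ J t (X 0 1) _ (hiF 0 h0 1 h1)
  have iF11 := integrable_mul_wgt_of_wNum F γ b₀ p₀ j Ts ρ ρ' τ Φ J t (X 1 1) _ (hiF 1 h1 1 h1)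
  have iFF00 := integrable_mul_wgt_of_wNum F γ b₀ p₀ j Ts ρ ρ' τ Φ J t (X 0 0) _ (hiFF 0 h0 0 h0)
  have iFF10 := integrable_mul_wgt_of_wNum F γ b₀ p₀ j Ts ρ ρ' τ Φ J t (X 1 0) _ (hiFF 1 h1 0 h0)
  have iFF01 := integrable_mul_wgt_of_wNum F γ b₀ p₀ j Ts ρ ρ' τ Φ J t (X 0 1) _ (hiFF 0 h0 1 h1)
  have iFF11 := integrable_mul_wgt_of_wNum F γ b₀ p₀ j Ts ρ ρ' τ Φ J t (X 1 1) _ (hiFF 1 h1 1 h1)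
  have iW00 : Integrable (fun z => (1:ℝ) * (wgt F γ b₀ p₀ j Ts ρ ρ' τ Φ J t) (X 0 0) z) τ :=
    integrable_mul_wgt_of_wNum F γ b₀ p₀ j Ts ρ ρ' τ Φ J t (X 0 0) _ (by simpa only [one_mul] using hi 0 h0 0 h0)
  have iW10 : Integrable (fun z => (1:ℝ) * (wgt F γ b₀ p₀ j Ts ρ ρ' τ Φ J t) (X 1 0) z) τ :=
    integrable_mul_wgt_of_wNum F γ b₀ p₀ j Ts ρ ρ' τ Φ J t (X 1 0) _ (by simpa only [one_mul] using hi 1 h1 0 h0)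
  have iW01 : Integrable (fun z => (1:ℝ) * (wgt F γ b₀ p₀ j Ts ρ ρ' τ Φ J t) (X 0 1) z) τ :=
    integrable_mul_wgt_of_wNum F γ b₀ p₀ j Ts ρ ρ' τ Φ J t (X 0 1) _ (by simpa only [one_mul] using hi 0 h0 1 h1)
  have iW11 : Integrable (fun z => (1:ℝ) * (wgt F γ b₀ p₀ j Ts ρ ρ' τ Φ J t) (X 1 1) z) τ :=
    integrable_mul_wgt_of_wNum F γ b₀ p₀ j Ts ρ ρ' τ Φ J t (X 1 1) _ (by simpa only [one_mul] using hi 1 h1 1 h1)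
  simp only [one_mul] at iW00 iW10 iW01 iW11
  have n00 := integral_wgt_eq_one F γ b₀ p₀ j Ts ρ ρ' τ Φ J t (X 0 0) (hZ 0 h0 0 h0)
  have n10 := integral_wgt_eq_one F γ b₀ p₀ j Ts ρ ρ' τ Φ J t (X 1 0) (hZ 1 h1 0 h0)
  have n01 := integral_wgt_eq_one F γ b₀ p₀ j Ts ρ ρ' τ Φ J t (X 0 1) (hZ 0 h0 1 h1)
  have n11 := integral_wgt_eq_one F γ b₀ p₀ j Ts ρ ρ' τ Φ J t (X 1 1) (hZ 1 h1 1 h1)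
  rw [hX00] at iF00 iFF00 iW00 n00
  rw [hX10] at iF10 iFF10 iW10 n10
  rw [hX01] at iF01 iFF01 iW01 n01
  rw [hX11] at iF11 iFF11 iW11 n11
  refine ⟨integrable_centred_sq (A := fun z => (Real.log (ρ Ts (Φ (V00, z))) - Real.log (ρ' Ts (Φ (V00, z))))) c₀₀ iF00 iFF00 iW00, integrable_centred_sq (A := fun z => (Real.log (ρ Ts (Φ (V00, z))) - Real.log (ρ' Ts (Φ (V00, z))))) c₁₀ iF10 iFF10 iW10,
    integrable_centred_sq (A := fun z => (Real.log (ρ Ts (Φ (V00, z))) - Real.log (ρ' Ts (Φ (V00, z))))) c₀₁ iF01 iFF01 iW01, integrable_centred_sq (A := fun z => (Real.log (ρ Ts (Φ (V00, z))) - Real.log (ρ' Ts (Φ (V00, z))))) c₁₁ iF11 iFF11 iW11, ?_⟩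
  have v00 : (∫ z, ((Real.log (ρ Ts (Φ (V00, z))) - Real.log (ρ' Ts (Φ (V00, z)))) - c₀₀) ^ 2 * (wgt F γ b₀ p₀ j Ts ρ ρ' τ Φ J t) V00 z ∂τ) = (∫ z, (Real.log (ρ Ts (Φ (V00, z))) - Real.log (ρ' Ts (Φ (V00, z)))) * (Real.log (ρ Ts (Φ (V00, z))) - Real.log (ρ' Ts (Φ (V00, z)))) * (wgt F γ b₀ p₀ j Ts ρ ρ' τ Φ J t) V00 z ∂τ) - (∫ z, (Real.log (ρ Ts (Φ (V00, z))) - Real.log (ρ' Ts (Φ (V00, z)))) * (wgt F γ b₀ p₀ j Ts ρ ρ' τ Φ J t) V00 z ∂τ) * (∫ z, (Real.log (ρ Ts (Φ (V00, z))) - Real.log (ρ' Ts (Φ (V00, z)))) * (wgt F γ b₀ p₀ j Ts ρ ρ' τ Φ J t) V00 z ∂τ) := by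
    rw [hc₀₀]; exact integral_centred_sq_eq (A := fun z => (Real.log (ρ Ts (Φ (V00, z))) - Real.log (ρ' Ts (Φ (V00, z))))) n00 iF00 iFF00 iW00
  have v10 : (∫ z, ((Real.log (ρ Ts (Φ (V00, z))) - Real.log (ρ' Ts (Φ (V00, z)))) - c₁₀) ^ 2 * (wgt F γ b₀ p₀ j Ts ρ ρ' τ Φ J t) V10 z ∂τ) = (∫ z, (Real.log (ρ Ts (Φ (V00, z))) - Real.log (ρ' Ts (Φ (V00, z)))) * (Real.log (ρ Ts (Φ (V00, z))) - Real.log (ρ' Ts (Φ (V00, z)))) * (wgt F γ b₀ p₀ j Ts ρ ρ' τ Φ J t) V10 z ∂τ) - (∫ z, (Real.log (ρ Ts (Φ (V00, z))) - Real.log (ρ' Ts (Φ (V00, z)))) * (wgt F γ b₀ p₀ j Ts ρ ρ' τ Φ J t) V10 z ∂τ) * (∫ z, (Real.log (ρ Ts (Φ (V00, z))) - Real.log (ρ' Ts (Φ (V00, z)))) * (wgt F γ b₀ p₀ j Ts ρ ρ' τ Φ J t) V10 z ∂τ) := by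
    rw [hc₁₀]; exact integral_centred_sq_eq (A := fun z => (Real.log (ρ Ts (Φ (V00, z))) - Real.log (ρ' Ts (Φ (V00, z))))) n10 iF10 iFF10 iW10
  have v01 : (∫ z, ((Real.log (ρ Ts (Φ (V00, z))) - Real.log (ρ' Ts (Φ (V00, z)))) - c₀₁) ^ 2 * (wgt F γ b₀ p₀ j Ts ρ ρ' τ Φ J t) V01 z ∂τ) = (∫ z, (Real.log (ρ Ts (Φ (V00, z))) - Real.log (ρ' Ts (Φ (V00, z)))) * (Real.log (ρ Ts (Φ (V00, z))) - Real.log (ρ' Ts (Φ (V00, z)))) * (wgt F γ b₀ p₀ j Ts ρ ρ' τ Φ J t) V01 z ∂τ) - (∫ z, (Real.log (ρ Ts (Φ (V00, z))) - Real.log (ρ' Ts (Φ (V00, z)))) * (wgt F γ b₀ p₀ j Ts ρ ρ' τ Φ J t) V01 z ∂τ) * (∫ z, (Real.log (ρ Ts (Φ (V00, z))) - Real.log (ρ' Ts (Φ (V00, z)))) * (wgt F γ b₀ p₀ j Ts ρ ρ' τ Φ J t) V01 z ∂τ) := by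
    rw [hc₀₁]; exact integral_centred_sq_eq (A := fun z => (Real.log (ρ Ts (Φ (V00, z))) - Real.log (ρ' Ts (Φ (V00, z))))) n01 iF01 iFF01 iW01
  have v11 : (∫ z, ((Real.log (ρ Ts (Φ (V00, z))) - Real.log (ρ' Ts (Φ (V00, z)))) - c₁₁) ^ 2 * (wgt F γ b₀ p₀ j Ts ρ ρ' τ Φ J t) V11 z ∂τ) = (∫ z, (Real.log (ρ Ts (Φ (V00, z))) - Real.log (ρ' Ts (Φ (V00, z)))) * (Real.log (ρ Ts (Φ (V00, z))) - Real.log (ρ' Ts (Φ (V00, z)))) * (wgt F γ b₀ p₀ j Ts ρ ρ' τ Φ J t) V11 z ∂τ) - (∫ z, (Real.log (ρ Ts (Φ (V00, z))) - Real.log (ρ' Ts (Φ (V00, z)))) * (wgt F γ b₀ p₀ j Ts ρ ρ' τ Φ J t) V11 z ∂τ) * (∫ z, (Real.log (ρ Ts (Φ (V00, z))) - Real.log (ρ' Ts (Φ (V00, z)))) * (wgt F γ b₀ p₀ j Ts ρ ρ' τ Φ J t) V11 z ∂τ) := by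
    rw [hc₁₁]; exact integral_centred_sq_eq (A := fun z => (Real.log (ρ Ts (Φ (V00, z))) - Real.log (ρ' Ts (Φ (V00, z))))) n11 iF11 iFF11 iW11
  rw [v00, v10, v01, v11]
  rw [integral_mul_wgt_eq_div F γ b₀ p₀ j Ts ρ ρ' τ Φ J t V00 (fun z => (Real.log (ρ Ts (Φ (V00, z))) - Real.log (ρ' Ts (Φ (V00, z)))) * (Real.log (ρ Ts (Φ (V00, z))) - Real.log (ρ' Ts (Φ (V00, z))))), integral_mul_wgt_eq_div F γ b₀ p₀ j Ts ρ ρ' τ Φ J t V00 (fun z => (Real.log (ρ Ts (Φ (V00, z))) - Real.log (ρ' Ts (Φ (V00, z))))),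
    integral_mul_wgt_eq_div F γ b₀ p₀ j Ts ρ ρ' τ Φ J t V10 (fun z => (Real.log (ρ Ts (Φ (V00, z))) - Real.log (ρ' Ts (Φ (V00, z)))) * (Real.log (ρ Ts (Φ (V00, z))) - Real.log (ρ' Ts (Φ (V00, z))))), integral_mul_wgt_eq_div F γ b₀ p₀ j Ts ρ ρ' τ Φ J t V10 (fun z => (Real.log (ρ Ts (Φ (V00, z))) - Real.log (ρ' Ts (Φ (V00, z))))),
    integral_mul_wgt_eq_div F γ b₀ p₀ j Ts ρ ρ' τ Φ J t V01 (fun z => (Real.log (ρ Ts (Φ (V00, z))) - Real.log (ρ' Ts (Φ (V00, z)))) * (Real.log (ρ Ts (Φ (V00, z))) - Real.log (ρ' Ts (Φ (V00, z))))), integral_mul_wgt_eq_div F γ b₀ p₀ j Ts ρ ρ' τ Φ J t V01 (fun z => (Real.log (ρ Ts (Φ (V00, z))) - Real.log (ρ' Ts (Φ (V00, z))))),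
    integral_mul_wgt_eq_div F γ b₀ p₀ j Ts ρ ρ' τ Φ J t V11 (fun z => (Real.log (ρ Ts (Φ (V00, z))) - Real.log (ρ' Ts (Φ (V00, z)))) * (Real.log (ρ Ts (Φ (V00, z))) - Real.log (ρ' Ts (Φ (V00, z))))), integral_mul_wgt_eq_div F γ b₀ p₀ j Ts ρ ρ' τ Φ J t V11 (fun z => (Real.log (ρ Ts (Φ (V00, z))) - Real.log (ρ' Ts (Φ (V00, z)))))]
  have hsq := abs_normVar_secondDiff_le_of_lip_ae (w := fun s s' z => wNum F γ b₀ p₀ j Ts ρ ρ' Φ J t (X s s') z) (Fo := fun z => (Real.log (ρ Ts (Φ (V00, z))) - Real.log (ρ' Ts (Φ (V00, z))))) hU hUI hmF hwm hi hiF hiFF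
    hlip hb₁i hlipF hb₁Fi hlipFF hb₁FFi hZ φ ψ Dφ Dψ hφ hψ hDφ hDψ hker
  rw [hψ, hψ, hψ, hψ, hφ, hφ, hφ, hφ, hX00, hX10, hX01, hX11] at hsq
  exact hsq

end VarSquare

end Summit.QuantumFields.YangMills.Theorems.OrganTangentLawSquareIntegrationLipAE

end
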